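import Summits.ValiantsHypothesis.ValiantsHypothesis.Theorems.BarrierLeverAnchoredDoorHitsLowerPairsSplitGeneralDesign

/-!
# Support item `AnchoredDoorHitsLowerPairs` (stmt-ValiantsHypothesis-22510), line `anchored-peeling`:
# CONJECTURE SP for all `m` — part 4: DEGREES IN THE SCALE `L` AND THE LIMIT (LEADING) DESIGN

Helper file (`--supports stmt-ValiantsHypothesis-22510`; cell valiant-natproofs, rung V4, 𝒟-side door (c); registered line
`Cruxes/AnchoredDoorHitsLowerPairs/Lines/anchored_peeling.lean` v24, registered stub `stub_splitFamilyGe3`; prover seat val-np-p1 gen 24;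
memo HOME/val-np-p1/g24/MEMO-SP-proof-valnp1-g24.md §3, §6 B2). Closes NO item.

WHAT. For the design `𝒟(L)` of `…SplitGeneralDesign` read over `ℂ[L]` (`L = X`): every door coefficient function `doorFunN (thetaN m X) (phiN m X) y C` is a
polynomial of degree `≤ dgN m y` (`d_ω = 0`, `d_{u_t} = |t| − 1`, `d_{v_P} = |P ∖ m|`; `natDegree_doorFunN_le`) and its coefficient at that degree is the
LIMIT DESIGN `vtopN m y C` (`coeff_doorFunN_top`): monomial personas `[C = P]`, `[C = sh t]`, `ω ↦ [C = {α}]`, and the α-parts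
`c_P ([C = {α} ∪ sh s] + [m ∉ P][C = {m, α} ∪ sh s])` (`s = P ∖ m`, `P ≠ {m}`), `v_{m} ↦ [C = {m}] + [α ∈ C ∧ C ∖ α ⊆ sh (range m)]` (memo §2.1, §3).

WHAT THIS IS NOT: no determinant here; nothing on crux stmt-ValiantsHypothesis-14610 or on `VP` versus `VNP`.
-/

set_option linter.dupNamespace false

namespace Summit.ValiantsHypothesis.ValiantsHypothesis.Theorems.BarrierLever.AnchoredPeeling

namespace SplitGeneral

open Finset DecFamily Polynomial

/-- The column degree of the vertex `y` in the scale `L`. -/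
def dgN (m y : ℕ) : ℕ :=
  if y < 2 ^ (m + 1) then ((bits y).erase m).card
  else if y + 1 < 2 ^ (m + 1) + 2 ^ m then (bits (y + 1 - 2 ^ (m + 1))).card - 1 else 0

/-- Indicator of a proposition as a complex number. -/
noncomputable def ind (p : Prop) [Decidable p] : ℂ := if p then 1 else 0

/-- **The limit (leading) design**: the coefficient functions of the monomial-persona doors (memo §2.1). -/
noncomputable def vtopN (m y : ℕ) (C : Finset ℕ) : ℂ :=
  if y < 2 ^ (m + 1) then
    (if bits y = ∅ then ind (C = {m + 1})
     else if bits y = {m} then ind (C = {m}) + ind (m + 1 ∈ C ∧ C.erase (m + 1) ⊆ sh m (range m))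
     else ind (C = bits y) + (cw m (bits y) : ℂ) *
       (ind (C = insert (m + 1) (sh m ((bits y).erase m))) + ind (m ∉ bits y ∧ C = insert m (insert (m + 1) (sh m ((bits y).erase m))))))
  else if y + 1 < 2 ^ (m + 1) + 2 ^ m then ind (C = sh m (bits (y + 1 - 2 ^ (m + 1)))) else 0

/-! ## 1. Elementary degree / coefficient facts -/

/-- Degree of `[c] · X^e`. -/
theorem natDegree_ite_X_pow_le {c : Prop} [Decidable c] {e e' : ℕ} (h : c → e ≤ e') :
    (if c then (X : ℂ[X]) ^ e else 0).natDegree ≤ e' := by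
  split_ifs with hc
  · rw [Polynomial.natDegree_X_pow]; exact h hc
  · rw [Polynomial.natDegree_zero]; exact Nat.zero_le _

/-- Coefficients of `[c] · X^e`. -/
theorem coeff_ite_X_pow {c : Prop} [Decidable c] (e d : ℕ) :
    (if c then (X : ℂ[X]) ^ e else 0).coeff d = if c ∧ d = e then 1 else 0 := by
  split_ifs with hc h2 h2
  · rw [Polynomial.coeff_X_pow, if_pos h2.2]
  · rw [Polynomial.coeff_X_pow, if_neg (fun h => h2 ⟨hc, h⟩)]
  · exact absurd h2.1 hc
  · rw [Polynomial.coeff_zero]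

/-- Degree of `[c] · a X^e`. -/
theorem natDegree_ite_C_mul_X_pow_le {c : Prop} [Decidable c] (a : ℂ) {e e' : ℕ} (h : c → e ≤ e') :
    (if c then Polynomial.C a * (X : ℂ[X]) ^ e else 0).natDegree ≤ e' := by
  split_ifs with hc
  · exact Polynomial.natDegree_C_mul_X_pow_le a e |>.trans (h hc)
  · rw [Polynomial.natDegree_zero]; exact Nat.zero_le _

/-- Coefficients of `[c] · a X^e`. -/
theorem coeff_ite_C_mul_X_pow {c : Prop} [Decidable c] (a : ℂ) (e d : ℕ) :
    (if c then Polynomial.C a * (X : ℂ[X]) ^ e else 0).coeff d = if c ∧ d = e then a else 0 := by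
  split_ifs with hc h2 h2
  · rw [Polynomial.coeff_C_mul_X_pow, if_pos h2.2]
  · rw [Polynomial.coeff_C_mul_X_pow, if_neg (fun h => h2 ⟨hc, h⟩)]
  · exact absurd h2.1 hc
  · rw [Polynomial.coeff_zero]

/-! ## 2. The `α`-part: exponent bookkeeping -/

/-- Under the tail condition, the `L`-exponent of the `α`-part is `≤ |s|`, with equality iff `sh m s ⊆ C` (`s = P ∖ m`). -/
theorem alpha_exp_le {m : ℕ} {P C : Finset ℕ} (hcond : C.erase (m + 1) ⊆ alphaTail m P) :
    ((C.erase (m + 1)).filter (fun b => b ≠ m)).card ≤ (P.erase m).card ∧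
      (((C.erase (m + 1)).filter (fun b => b ≠ m)).card = (P.erase m).card ↔ sh m (P.erase m) ⊆ C) := by
  have hsub : (C.erase (m + 1)).filter (fun b => b ≠ m) ⊆ sh m (P.erase m) := by
    intro b hb
    obtain ⟨hb1, hbm⟩ := Finset.mem_filter.mp hb
    have := hcond hb1
    rw [alphaTail, Finset.mem_union] at this
    rcases this with hK | hsh
    · split_ifs at hK with hmP
      · exact absurd hK (Finset.notMem_empty b)
      · exact absurd (Finset.mem_singleton.mp hK) hbm
    · exact hsh
  refine ⟨(Finset.card_le_card hsub).trans (by rw [card_sh]), ?_⟩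
  rw [← card_sh m (P.erase m)]
  constructor
  · intro heq
    have hEq : (C.erase (m + 1)).filter (fun b => b ≠ m) = sh m (P.erase m) := Finset.eq_of_subset_of_card_le hsub (by rw [heq])
    intro b hb
    have : b ∈ (C.erase (m + 1)).filter (fun b => b ≠ m) := hEq ▸ hb
    exact Finset.mem_of_mem_erase (Finset.mem_filter.mp this).1
  · intro hsh
    refine le_antisymm (Finset.card_le_card hsub) (Finset.card_le_card (fun b hb => ?_))
    have hle := le_of_mem_sh hb
    exact Finset.mem_filter.mpr ⟨Finset.mem_erase.mpr ⟨by omega, hsh hb⟩, by omega⟩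

/-- The top condition of the `α`-part: tails inside `alphaTail` and all of `sh m s` present ⟺ `C` is one of the two limit faces. -/
theorem alpha_top_iff {m : ℕ} {P C : Finset ℕ} :
    (m + 1 ∈ C ∧ C.erase (m + 1) ⊆ alphaTail m P) ∧ sh m (P.erase m) ⊆ C ↔
      C = insert (m + 1) (sh m (P.erase m)) ∨ (m ∉ P ∧ C = insert m (insert (m + 1) (sh m (P.erase m)))) := by
  set s := P.erase m
  constructor
  · rintro ⟨⟨h1, hcond⟩, hsh⟩
    by_cases hmC : m ∈ C
    · right
      have hmK : m ∉ P := by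
        have := hcond (Finset.mem_erase.mpr ⟨by omega, hmC⟩)
        rw [alphaTail, Finset.mem_union] at this
        rcases this with hK | hsh'
        · split_ifs at hK with hmP
          · exact absurd hK (Finset.notMem_empty m)
          · exact hmP
        · have := le_of_mem_sh hsh'; omega
      refine ⟨hmK, ?_⟩
      ext b
      simp only [Finset.mem_insert]
      constructor
      · intro hb
        by_cases hb1 : b = m + 1
        · exact Or.inr (Or.inl hb1)
        by_cases hbm : b = m
        · exact Or.inl hbm
        have := hcond (Finset.mem_erase.mpr ⟨hb1, hb⟩)
        rw [alphaTail, Finset.mem_union] at this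
        rcases this with hK | hsh'
        · rw [if_neg hmK, Finset.mem_singleton] at hK; exact absurd hK hbm
        · exact Or.inr (Or.inr hsh')
      · rintro (rfl | rfl | hb)
        exacts [hmC, h1, hsh hb]
    · left
      ext b
      simp only [Finset.mem_insert]
      constructor
      · intro hb
        by_cases hb1 : b = m + 1
        · exact Or.inl hb1
        have := hcond (Finset.mem_erase.mpr ⟨hb1, hb⟩)
        rw [alphaTail, Finset.mem_union] at this
        rcases this with hK | hsh'
        · split_ifs at hK with hmP
          · exact absurd hK (Finset.notMem_empty b)
          · rw [Finset.mem_singleton] at hK; exact absurd (hK ▸ hb) hmC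
        · exact Or.inr hsh'
      · rintro (rfl | hb)
        exacts [h1, hsh hb]
  · rintro (hC | ⟨hmP, hC⟩)
    · refine ⟨⟨hC ▸ Finset.mem_insert_self _ _, fun b hb => ?_⟩, fun b hb => hC ▸ Finset.mem_insert_of_mem hb⟩
      obtain ⟨hb1, hbC⟩ := Finset.mem_erase.mp hb
      rw [hC, Finset.mem_insert] at hbC
      rcases hbC with hb | hb
      · exact absurd hb hb1
      · exact Finset.mem_union_right _ hb
    · refine ⟨⟨hC ▸ Finset.mem_insert_of_mem (Finset.mem_insert_self _ _), fun b hb => ?_⟩,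
        fun b hb => hC ▸ Finset.mem_insert_of_mem (Finset.mem_insert_of_mem hb)⟩
      obtain ⟨hb1, hbC⟩ := Finset.mem_erase.mp hb
      rw [hC, Finset.mem_insert, Finset.mem_insert] at hbC
      rcases hbC with hb | hb | hb
      · rw [alphaTail, hb, if_neg hmP]; exact Finset.mem_union_left _ (Finset.mem_singleton_self m)
      · exact absurd hb hb1
      · exact Finset.mem_union_right _ hb

/-- The persona condition forces `C ⊆ P`; at full degree it forces `C = P`. -/
theorem persona_top_iff {m : ℕ} {P C : Finset ℕ} (hP : P.Nonempty) :
    (P.min' hP ∈ C ∧ C.erase (P.min' hP) ⊆ P.erase (P.min' hP)) ∧ (if m ∈ P then 0 else 1) + (C.card - 1) = (P.erase m).card ↔ C = P := by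
  set p₀ := P.min' hP
  have hp₀ : p₀ ∈ P := Finset.min'_mem P hP
  constructor
  · rintro ⟨⟨h0, hsub⟩, hcard⟩
    have hCP : C ⊆ P := fun b hb => by
      by_cases hb0 : b = p₀
      · rw [hb0]; exact hp₀
      · exact Finset.mem_of_mem_erase (hsub (Finset.mem_erase.mpr ⟨hb0, hb⟩))
    refine Finset.eq_of_subset_of_card_le hCP (le_of_eq ?_)
    have hC1 : 1 ≤ C.card := Finset.card_pos.mpr ⟨p₀, h0⟩
    by_cases hmP : m ∈ P
    · rw [if_pos hmP, Finset.card_erase_of_mem hmP] at hcard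
      have := Finset.card_pos.mpr hP; omega
    · rw [if_neg hmP, Finset.erase_eq_of_notMem hmP] at hcard; omega
  · intro hC
    subst hC
    refine ⟨⟨hp₀, subset_rfl⟩, ?_⟩
    have hC1 : 1 ≤ C.card := Finset.card_pos.mpr hP
    by_cases hmP : m ∈ C
    · rw [if_pos hmP, Finset.card_erase_of_mem hmP]; omega
    · rw [if_neg hmP, Finset.erase_eq_of_notMem hmP]; omega

/-! ## 3. Degrees and top coefficients, vertex by vertex -/

/-- The persona factor as a single power of `L`. -/
theorem persona_factor_eq (m : ℕ) (P : Finset ℕ) (k : ℕ) :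
    (if m ∈ P then (1 : ℂ[X]) else X) * X ^ k = X ^ ((if m ∈ P then 0 else 1) + k) := by
  split_ifs <;> simp [pow_succ, pow_add]

/-- **Degree bound** for every vertex. -/
theorem natDegree_doorFunN_le (m y : ℕ) (C : Finset ℕ) :
    (doorFunN (thetaN m (X : ℂ[X])) (phiN m X) y C).natDegree ≤ dgN m y := by
  classical
  by_cases hy : y < 2 ^ (m + 1)
  · unfold dgN; rw [if_pos hy]
    by_cases hP : (bits y).Nonempty
    · by_cases hPm : bits y = {m}
      · rw [doorFunN_top m X hy hPm, hPm, Finset.erase_singleton, Finset.card_empty]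
        refine (Polynomial.natDegree_add_le _ _).trans (max_le ?_ ?_) <;>
          · split_ifs <;> simp
      · rw [doorFunN_clique m X hy hP hPm, persona_factor_eq]
        refine (Polynomial.natDegree_add_le _ _).trans (max_le ?_ ?_)
        · refine natDegree_ite_X_pow_le (fun hc => ?_)
          -- `C ⊆ P`
          have hCP : C ⊆ bits y := fun b hb => by
            by_cases hb0 : b = (bits y).min' hP
            · rw [hb0]; exact Finset.min'_mem _ hP
            · exact Finset.mem_of_mem_erase (hc.2 (Finset.mem_erase.mpr ⟨hb0, hb⟩))
          have hcard := Finset.card_le_card hCP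
          have hC1 : 1 ≤ C.card := Finset.card_pos.mpr ⟨_, hc.1⟩
          by_cases hmP : m ∈ bits y
          · rw [if_pos hmP, Finset.card_erase_of_mem hmP]; omega
          · rw [if_neg hmP, Finset.erase_eq_of_notMem hmP]; omega
        · rw [← map_natCast Polynomial.C]
          exact natDegree_ite_C_mul_X_pow_le _ (fun hc => (alpha_exp_le hc.2).1)
    · have h0 : y = 0 := by
        have : bits y = ∅ := Finset.not_nonempty_iff_eq_empty.mp hP
        exact bits_eq_empty_iff.mp this
      subst h0
      rw [doorFunN_omega]
      split_ifs <;> simp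
  · by_cases hy' : y + 1 < 2 ^ (m + 1) + 2 ^ m
    · unfold dgN; rw [if_neg hy, if_pos hy']
      have ht : (bits (y + 1 - 2 ^ (m + 1))).Nonempty := by
        rw [Finset.nonempty_iff_ne_empty, Ne, bits_eq_empty_iff]; omega
      rw [doorFunN_indep m X hy hy' ht C]
      refine natDegree_ite_X_pow_le (fun hc => ?_)
      have := Finset.card_le_card hc.2
      rw [card_sh] at this; omega
    · rw [doorFunN_none m X hy hy', Polynomial.natDegree_zero]; exact Nat.zero_le _

/-- **Top coefficient = the limit design**, for every vertex and every face `C`. -/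
theorem coeff_doorFunN_top (m y : ℕ) (C : Finset ℕ) :
    (doorFunN (thetaN m (X : ℂ[X])) (phiN m X) y C).coeff (dgN m y) = vtopN m y C := by
  classical
  by_cases hy : y < 2 ^ (m + 1)
  · unfold dgN vtopN; rw [if_pos hy, if_pos hy]
    by_cases hP : (bits y).Nonempty
    · rw [if_neg (Finset.nonempty_iff_ne_empty.mp hP)]
      by_cases hPm : bits y = {m}
      · rw [if_pos hPm, doorFunN_top m X hy hPm, hPm, Finset.erase_singleton, Finset.card_empty, Polynomial.coeff_add]
        unfold ind
        congr 1 <;> split_ifs <;> simp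
      · rw [if_neg hPm, doorFunN_clique m X hy hP hPm, persona_factor_eq, Polynomial.coeff_add, coeff_ite_X_pow, ← map_natCast Polynomial.C,
          coeff_ite_C_mul_X_pow]
        unfold ind
        congr 1
        · -- persona: `C = P`
          have hiff := persona_top_iff (m := m) (C := C) hP
          by_cases hC : C = bits y
          · rw [if_pos hC, if_pos]; rw [eq_comm]; exact hiff.mpr hC
          · rw [if_neg hC, if_neg]; intro h; exact hC (hiff.mp ⟨h.1, h.2.symm⟩)
        · -- α part
          have key : ((m + 1 ∈ C ∧ C.erase (m + 1) ⊆ alphaTail m (bits y)) ∧ ((bits y).erase m).card =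
              ((C.erase (m + 1)).filter (fun b => b ≠ m)).card) ↔
              (C = insert (m + 1) (sh m ((bits y).erase m)) ∨ (m ∉ bits y ∧ C = insert m (insert (m + 1) (sh m ((bits y).erase m))))) := by
            rw [← alpha_top_iff]
            constructor
            · rintro ⟨hc, hcard⟩; exact ⟨hc, ((alpha_exp_le hc.2).2).mp hcard.symm⟩
            · rintro ⟨hc, hsh⟩; exact ⟨hc, (((alpha_exp_le hc.2).2).mpr hsh).symm⟩
          by_cases h1 : C = insert (m + 1) (sh m ((bits y).erase m))
          · have h2 : ¬ (m ∉ bits y ∧ C = insert m (insert (m + 1) (sh m ((bits y).erase m)))) := by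
              rintro ⟨_, hC⟩
              have : m ∈ C := hC ▸ Finset.mem_insert_self _ _
              rw [h1, Finset.mem_insert] at this
              rcases this with h | h
              · omega
              · have := le_of_mem_sh h; omega
            rw [if_pos (key.mpr (Or.inl h1)), if_pos h1, if_neg h2]; ring
          · by_cases h2 : m ∉ bits y ∧ C = insert m (insert (m + 1) (sh m ((bits y).erase m)))
            · rw [if_pos (key.mpr (Or.inr h2)), if_neg h1, if_pos h2]; ring
            · rw [if_neg (fun h => (key.mp h).elim h1 h2), if_neg h1, if_neg h2]; ring
    · have h0 : y = 0 := by
        have : bits y = ∅ := Finset.not_nonempty_iff_eq_empty.mp hP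
        exact bits_eq_empty_iff.mp this
      subst h0
      rw [if_pos (bits_eq_empty_iff.mpr rfl), doorFunN_omega]
      unfold ind
      have : (bits 0).erase m = ∅ := by rw [bits_eq_empty_iff.mpr rfl, Finset.erase_empty]
      rw [this, Finset.card_empty]
      split_ifs <;> simp
  · unfold dgN vtopN; rw [if_neg hy, if_neg hy]
    by_cases hy' : y + 1 < 2 ^ (m + 1) + 2 ^ m
    · rw [if_pos hy', if_pos hy']
      have ht : (bits (y + 1 - 2 ^ (m + 1))).Nonempty := by
        rw [Finset.nonempty_iff_ne_empty, Ne, bits_eq_empty_iff]; omega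
      rw [doorFunN_indep m X hy hy' ht C, coeff_ite_X_pow]
      unfold ind
      set t := bits (y + 1 - 2 ^ (m + 1))
      have hr₀ : m + 2 + t.min' ht ∈ sh m t := mem_sh.mpr ⟨by omega, by
        have : m + 2 + t.min' ht - (m + 2) = t.min' ht := by omega
        rw [this]; exact Finset.min'_mem t ht⟩
      by_cases hC : C = sh m t
      · rw [if_pos hC, if_pos]
        refine ⟨⟨hC ▸ hr₀, hC ▸ subset_rfl⟩, ?_⟩
        rw [hC, card_sh]
      · rw [if_neg hC, if_neg]
        rintro ⟨⟨h0, hsub⟩, hcard⟩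
        apply hC
        refine Finset.eq_of_subset_of_card_le hsub ?_
        have hC1 : 1 ≤ C.card := Finset.card_pos.mpr ⟨_, h0⟩
        have ht1 : 1 ≤ t.card := Finset.card_pos.mpr ht
        have hcard' : t.card - 1 = C.card - 1 := hcard
        have hsh : (sh m t).card = t.card := card_sh m t
        omega
    · rw [if_neg hy', if_neg hy', doorFunN_none m X hy hy', Polynomial.coeff_zero]

end SplitGeneral

end Summit.ValiantsHypothesis.ValiantsHypothesis.Theorems.BarrierLever.AnchoredPeeling
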